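import Summits.QuantumFields.YangMills.Theorems.FlatTubeReductionDecimationDefs
import Literature.Probability.Independence.HoeffdingDecompositionParts
import HarnessLib

/-!
# Route `FlatTubeReduction`, crux `PinnedUnitStepEx` (stmt-QuantumFields-27561), stub `stub_smearVarPosGS1` — D1a: the decimation read through a
# translation, and transport of «depends only on» to the fine support

Seat ym-line-fcl-p3 g9 (2026-08-28).  Blueprint `WINJ-lean-blueprint-fcl-p3-g9.md` (evidence on the item), beginning of file D1: for the decoder
`v ∈ (ℤ/L)³` the coarse link `e'` of `thin L' (τ_v U)` is the (ordered product of the) fine link(s) `pathLinks L v e'` (`thin_shift_apply`,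
`thin_shift_congr`), hence a coarse function depending only on the links in `R` pulls back to a fine function depending only on `fineSupp L v R`
(`dependsOff_comp_thin_shift`) — the «depends only on» half of memo §P2 for the Hoeffding parts `g^{=R}`.  The exactness half (one-link Haar
invariance through a doubled path) and the fine identity (★) are the next files.  R2b1 RECORD rung; nothing here is a summit, a crux or the stub.
-/

set_option autoImplicit false

noncomputable section

namespace Summit.QuantumFields.YangMills.Theorems.FlatTubeReduction.Decimation

open MeasureTheory Finset Function
open Literature.MathematicalPhysics.QuantumFieldTheory (Site Edge GaugeConfig)
open Literature.MathematicalPhysics.QuantumFieldTheory.TorusTranslation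
open Summit.QuantumFields.YangMills.Theorems.FemtoCutoffLadder.Thinning (thin thinSite thinSteps thin_apply)
open Literature.Probability.Independence.Hoeffding

variable {G : Type*} [Group G] [MeasurableSpace G] {L L' : ℕ}

/-- Membership in the path links. [folklore] -/
theorem mem_pathLinks {v : Site 3 L} {e' : Edge 3 L'} {f : Edge 3 L} :
    f ∈ pathLinks L v e' ↔ ∃ s, s < thinSteps L L' (e'.1 e'.2) ∧ f = (thinSite L e'.1 + Pi.single e'.2 ((s : ℕ) : ZMod L) - v, e'.2) := by
  simp only [pathLinks, Finset.mem_image, Finset.mem_range]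
  constructor
  · rintro ⟨s, hs, rfl⟩; exact ⟨s, hs, rfl⟩
  · rintro ⟨s, hs, rfl⟩; exact ⟨s, hs, rfl⟩

/-- Membership in the fine support. [folklore] -/
theorem mem_fineSupp {v : Site 3 L} {R : Finset (Edge 3 L')} {f : Edge 3 L} :
    f ∈ fineSupp L v R ↔ ∃ e' ∈ R, f ∈ pathLinks L v e' := by
  simp [fineSupp]

/-- The first link of the path is a path link. [folklore] -/
theorem base_mem_pathLinks (v : Site 3 L) (e' : Edge 3 L') : (thinSite L e'.1 - v, e'.2) ∈ pathLinks L v e' := by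
  rw [mem_pathLinks]
  refine ⟨0, ?_, by simp⟩
  unfold thinSteps; split_ifs <;> omega

/-- When the coarse link is doubled, the second link of the path is a path link. [folklore] -/
theorem shift_mem_pathLinks (v : Site 3 L) {e' : Edge 3 L'} (h : (e'.1 e'.2).val < L - L') :
    (thinSite L e'.1 + Pi.single e'.2 1 - v, e'.2) ∈ pathLinks L v e' := by
  rw [mem_pathLinks]
  refine ⟨1, ?_, by simp⟩
  simp [thinSteps, h]

/-- **The decimation read through a translation**: `(thin L' (τ_v U))(x', i)` is the fine link at `thinSite x' − v`, times the next one when the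
coarse link is doubled. [folklore] -/
theorem thin_shift_apply (U : GaugeConfig 3 L G) (v : Site 3 L) (x' : Site 3 L') (i : Fin 3) :
    thin L' (torusConfigShift v U) (x', i) =
      if (x' i).val < L - L' then U (thinSite L x' - v, i) * U (thinSite L x' + Pi.single i 1 - v, i)
      else U (thinSite L x' - v, i) := by
  rw [thin_apply]
  simp only [torusConfigShift_apply, Literature.MathematicalPhysics.QuantumFieldTheory.Site.shift]

/-- Two fine configurations agreeing on the path links of `e'` give the same coarse link `e'`. [folklore] -/
theorem thin_shift_congr {U U' : GaugeConfig 3 L G} {v : Site 3 L} {e' : Edge 3 L'} (h : ∀ f ∈ pathLinks L v e', U f = U' f) :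
    thin L' (torusConfigShift v U) e' = thin L' (torusConfigShift v U') e' := by
  obtain ⟨x', i⟩ := e'
  rw [thin_shift_apply, thin_shift_apply]
  split_ifs with hd
  · rw [h _ (base_mem_pathLinks v (x', i)), h _ (shift_mem_pathLinks v (e' := (x', i)) hd)]
  · rw [h _ (base_mem_pathLinks v (x', i))]

/-- **Transport of «depends only on»**: if a coarse function depends only on the links in `R`, its decimation pull-back through the decoder `v`
depends only on the fine links in `fineSupp L v R`. [folklore] -/
theorem dependsOff_comp_thin_shift [NeZero L] [NeZero L'] {g : GaugeConfig 3 L' G → ℝ} {R : Finset (Edge 3 L')} (hg : DependsOff (univ \ R) g) (v : Site 3 L) :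
    DependsOff (univ \ fineSupp L v R) (fun U : GaugeConfig 3 L G => g (thin L' (torusConfigShift v U))) := by
  intro U U' hUU'
  refine hg _ _ fun e' he' => ?_
  have he'R : e' ∈ R := by
    by_contra h
    exact he' (Finset.mem_sdiff.2 ⟨Finset.mem_univ _, h⟩)
  refine thin_shift_congr fun f hf => hUU' f fun hfs => ?_
  exact (Finset.mem_sdiff.1 hfs).2 (mem_fineSupp.2 ⟨e', he'R, hf⟩)

end Summit.QuantumFields.YangMills.Theorems.FlatTubeReduction.Decimation
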